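import Mathlib
import HarnessLib

/-!
# Route `KimAtThreeKolyvagin` (rung W2), crux `StubAtEmptyLevelThree` (item 19561): DUAL SATURATION from
# orders — the dual Selmer orders at two levels agree (the last input of the counts (iii) of the liftability road)

Cell `bsd-addord`, seat `bsd-addord-w2-c2` (gen 3). TOOL FILE, pure algebra (Mathlib only): theorems only, no
definition, no named fact, no `sorry`; closes nothing; books nothing. HONEST FRAMING: BSD is not proved by any of
this; item 19561 stays OPEN.

Mazur–Rubin (*Kolyvagin systems*, Lemma 4.1.1 (ii) and the proof of Thm. 4.4.3) compare the dual Selmer groups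
`H¹_{𝓕*}(ℚ, T*[𝔪^i]) ≅ H¹_{𝓕*}(ℚ, T*)[𝔪^i]` across levels. The tree has no cross-level maps between the dual
Selmer groups of `E[3^{j+1}]` and `E[3^{k̃+1}]`; this file replaces them by ORDER bookkeeping on the Selmer side:
if the bottom classes of the generators at levels `j ≤ k̃` are proportional by a unit after reduction
(`red_*(g̃_∅) = w • g_j ∅`, the landed liftability relation `KimAtThreeStubOfLiftable.apply_empty_eq_zsmul_of_coreVertex`),
the kernel of `red_*` is the `3^{k̃−j}`-torsion (landed), and [S24] Thm. 4.4 (2) holds in ORDER form at both levels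
(`ord(g_∅)·#N = 3^{level+1}` or `g_∅ = 0`), then `#N_j = #N_{k̃}` as soon as `log₃ #N_{k̃} ≤ j`.

* `nsmul_eq_zero_iff_of_isCoprime` — `3^a • (w • y) = 0 ↔ 3^a • y = 0` for `w` prime to `3`, `3^{b} • y = 0`.
* `pow_nsmul_eq_zero_iff_of_addOrderOf_eq` — `3^a • y = 0 ↔ c ≤ a` when `ord(y) = 3^c`.
* `dual_exponent_eq_of_orders` — the saturation statement above (abstract additive groups).

References: [MazurRubin2004] Lemma 4.1.1 (ii) (p. 35), Thm. 4.1.13, Thm. 4.4.3 (p. 47); [Sakamoto2024] Thm. 4.4 (2).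
-/

-- the Theorems namespace of a single-conjunct summit repeats the summit name by design (D-0017)
set_option linter.dupNamespace false

namespace Summit.BirchSwinnertonDyer.BirchSwinnertonDyer.Theorems.KimAtThreeStubOfLiftable

variable {A B : Type*} [AddCommGroup A] [AddCommGroup B]

/-- `3^a • (w • y) = 0 ↔ 3^a • y = 0` when `w` is prime to `3` and `y` is killed by a power of `3`.
[cite: MazurRubin2004, Thm. 4.4.3 (proof, p. 47)] -/
theorem nsmul_eq_zero_iff_of_isCoprime {p : ℕ} {w : ℤ} (hw : IsCoprime w p) {y : A} {b : ℕ}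
    (hkill : p ^ b • y = 0) (a : ℕ) : p ^ a • (w • y) = 0 ↔ p ^ a • y = 0 := by
  constructor
  · intro h
    obtain ⟨α, β, hab⟩ := hw.pow_right (n := b)
    have hz1 : w • (p ^ a • y) = 0 := by rwa [smul_comm] at h
    have hz2 : ((p : ℤ) ^ b) • (p ^ a • y) = 0 := by
      rw [← Int.natCast_pow, natCast_zsmul, smul_comm, hkill, smul_zero]
    calc p ^ a • y = (1 : ℤ) • (p ^ a • y) := (one_zsmul _).symm
      _ = (α * w + β * (p : ℤ) ^ b) • (p ^ a • y) := by rw [hab]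
      _ = α • (w • (p ^ a • y)) + β • (((p : ℤ) ^ b) • (p ^ a • y)) := by
          rw [add_zsmul, mul_zsmul, mul_zsmul]
      _ = 0 := by rw [hz1, hz2, smul_zero, smul_zero, add_zero]
  · intro h
    rw [smul_comm, h, smul_zero]

/-- `3^a • y = 0 ↔ c ≤ a` when `ord(y) = 3^c`. [folklore] -/
theorem pow_nsmul_eq_zero_iff_of_addOrderOf_eq {p : ℕ} (hp : p.Prime) {y : A} {c : ℕ}
    (hy : addOrderOf y = p ^ c) (a : ℕ) : p ^ a • y = 0 ↔ c ≤ a := by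
  rw [← addOrderOf_dvd_iff_nsmul_eq_zero, hy]
  exact Nat.pow_dvd_pow_iff_le_right hp.one_lt

/-- **Dual saturation from orders.** Abstract levels `j ≤ k̃` with gap `g = k̃ − j`: `φ = red_*` with
`3^a • φ(y) = 0 ↔ 3^{a+g} • y = 0` on the lift class `yt = g̃_∅` (kernel = `3^g`-torsion); the proportionality
`φ yt = w • yj` with `w` prime to `3` and `3^{j+1} • yj = 0`; the ORDER of `yt`, `ord(yt) = 3^{k̃+1−nt}` ([S24]
Thm. 4.4 (2) clause 1 at the lift level, `nt = log₃ #N_{k̃} ≤ k̃`); and [S24] Thm. 4.4 (2) at level `j` in the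
two-clause form for `nj = log₃ #N_j`. If `nt ≤ j` then `nj = nt`.
[cite: MazurRubin2004, Lemma 4.1.1 (ii) (p. 35) and Thm. 4.4.3 (p. 47)] [cite: Sakamoto2024, Thm. 4.4 (2) (p. 926)] -/
theorem dual_exponent_eq_of_orders (φ : B →+ A) {j kt g nt nj : ℕ} (hg : j + g = kt) (hnt : nt ≤ j)
    {yt : B} {yj : A} {w : ℤ} (hw : IsCoprime w 3)
    (hker : ∀ a : ℕ, 3 ^ a • φ yt = 0 ↔ 3 ^ (a + g) • yt = 0)
    (hcmp : φ yt = w • yj) (hkill : 3 ^ (j + 1) • yj = 0)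
    (hordt : addOrderOf yt = 3 ^ (kt + 1 - nt))
    (h1j : nj ≤ j + 1 → addOrderOf yj * 3 ^ nj = 3 ^ (j + 1))
    (h2j : j + 1 ≤ nj → yj = 0) : nj = nt := by
  -- `3^a • yj = 0 ↔ j + 1 - nt ≤ a`
  have key : ∀ a : ℕ, 3 ^ a • yj = 0 ↔ j + 1 - nt ≤ a := by
    intro a
    rw [← nsmul_eq_zero_iff_of_isCoprime hw hkill a, ← hcmp, hker a,
      pow_nsmul_eq_zero_iff_of_addOrderOf_eq Nat.prime_three hordt]
    omega
  -- `yj ≠ 0` (take `a = 0`: `j + 1 - nt ≥ 1`)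
  have hyj : yj ≠ 0 := by
    intro h
    have := (key 0).mp (by rw [h, smul_zero])
    omega
  -- hence `nj ≤ j` and clause 1 applies
  have hnj : nj ≤ j := by
    by_contra hlt
    exact hyj (h2j (by omega))
  have hordj : addOrderOf yj = 3 ^ (j + 1 - nj) := by
    have h := h1j (by omega)
    have hsplit : 3 ^ (j + 1) = 3 ^ (j + 1 - nj) * 3 ^ nj := by rw [← pow_add, Nat.sub_add_cancel (by omega)]
    rw [hsplit] at h
    exact Nat.eq_of_mul_eq_mul_right (pow_pos (by norm_num) _) h
  -- compare the two descriptions of `ord(yj)`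
  have h1 := (key (j + 1 - nt)).mpr le_rfl
  have h2 : ¬ 3 ^ (j - nt) • yj = 0 := fun h => by have := (key (j - nt)).mp h; omega
  rw [pow_nsmul_eq_zero_iff_of_addOrderOf_eq Nat.prime_three hordj] at h1 h2
  omega

end Summit.BirchSwinnertonDyer.BirchSwinnertonDyer.Theorems.KimAtThreeStubOfLiftable
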